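import Literature.Geometry.Riemannian.ThreeShrinkerCompactReduction
import Literature.Geometry.Riemannian.ParallelTransport
import Literature.Geometry.Lorentzian.OpensChartGeodesicODE
import Literature.Geometry.Lorentzian.FlatDevelopment
import Literature.Geometry.Lorentzian.HypersurfaceRestriction
import HarnessLib

/-!
# Geodesics of a manifold read in a chart: the coordinate geodesic equations with `chrAt`

For a smooth pseudo-Riemannian metric `g` on a manifold `M` modelled on `𝓘(ℝ, E)` and a geodesic
`γ` of its Levi-Civita connection, the coordinate expression `c = extChartAt x₁ ∘ γ` in the chart
at `x₁` solves, near every parameter `t₀` with `γ t₀` in the chart domain, the classical geodesic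
equations `c'' + Γ_c(c', c') = 0`, where `Γ = MetricCoord.chrAt G` is the Christoffel map of the
chart components `G = chartRep 𝓘(ℝ, E) g x₁ 0` (O'Neill 1983, Ch. 3, Cor. 3.21), and the
coordinate velocity `c' = D(extChartAt x₁)(γ')` is carried back to `γ'` by `D(chartInv x₁)`.

* `mfderiv_chartInv_mfderiv_extChartAt` — `D(chartInv)_{φ x} (D(extChartAt)_x v) = v`;
* `isGeodesicOn_chartInv_comp` — a geodesic `ĉ` of the chart metric `chartPullback g x₁` on the
  open chart target is carried by `chartInv x₁` to a geodesic of `g`, with velocity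
  `D(chartInv)(ĉ')` (naturality of `D/dt`, `mfderiv_covariantDerivAlong_comap`);
* **`IsGeodesicOn.eventually_hasDerivAt_chart`** — the coordinate geodesic equations for `γ`
  near `t₀`: `HasDerivAt c (U t) t` and `HasDerivAt U (−chrAt G (c t) (U t) (U t)) t` with
  `U = D(extChartAt x₁)(γ')`. Proof: solve the coordinate system locally (Picard–Lindelöf), read
  the solution as a geodesic of the chart metric (`OpensChart.isGeodesicOn_of_hasDerivAt`,
  `OpensChart.christoffel_eq_chrAt`), push it to `M` by `chartInv`, and identify it with `γ` by
  the uniqueness of geodesics (`eqOn_of_isGeodesicOn`).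

This is the bridge by which the coordinate tensor calculus of the `MetricCoord` layer is applied
along the global geodesics (Hopf–Rinow minimizers, complete geodesics) of the tree. Everything is
proved; no definitions are introduced.

## References

* B. O'Neill, *Semi-Riemannian geometry*, Academic Press 1983, Ch. 3, Prop. 3.13, Cor. 3.21,
  Lemma 3.22, Prop. 3.59. [ONeill1983]
-/

noncomputable section

set_option maxSynthPendingDepth 3

open Bundle Set Function Filter Module Metric
open scoped Manifold ContDiff Topology

namespace Literature.Geometry.Riemannian

open Lorentzian Lorentzian.PseudoRiemannianMetric

universe u

variable {E : Type u} [NormedAddCommGroup E] [NormedSpace ℝ E] [FiniteDimensional ℝ E]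
  [CompleteSpace E] {M : Type*} [TopologicalSpace M] [ChartedSpace E M] [IsManifold 𝓘(ℝ, E) ∞ M]
  (g : PseudoRiemannianMetric 𝓘(ℝ, E) ∞ E (TangentSpace 𝓘(ℝ, E) : M → Type _))

/-! ### The differentials of the chart and of its inverse -/

omit [FiniteDimensional ℝ E] [CompleteSpace E] in
/-- **`D(chartInv)_{φ x} ∘ D(extChartAt)_x = id`** on `T_x M` for `x` in the chart domain
(`D(extChartAt) ∘ D(chartInv) = id` and `D(extChartAt)_x` is invertible). [folklore] -/
theorem mfderiv_chartInv_mfderiv_extChartAt (x₁ : M) {x : M}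
    (hx : x ∈ (extChartAt 𝓘(ℝ, E) x₁).source) (v : TangentSpace 𝓘(ℝ, E) x) :
    mfderiv 𝓘(ℝ, E) 𝓘(ℝ, E) (chartInv 𝓘(ℝ, E) x₁)
      ⟨extChartAt 𝓘(ℝ, E) x₁ x, (extChartAt 𝓘(ℝ, E) x₁).map_source hx⟩
      (mfderiv 𝓘(ℝ, E) 𝓘(ℝ, E) (extChartAt 𝓘(ℝ, E) x₁) x v) = v := by
  set u : chartTarget 𝓘(ℝ, E) x₁ := ⟨extChartAt 𝓘(ℝ, E) x₁ x, (extChartAt 𝓘(ℝ, E) x₁).map_source hx⟩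
    with hu
  have hux : chartInv 𝓘(ℝ, E) x₁ u = x := (extChartAt 𝓘(ℝ, E) x₁).left_inv hx
  have hinv := isInvertible_mfderiv_extChartAt (I := 𝓘(ℝ, E)) hx
  apply hinv.injective
  have h := mfderiv_extChartAt_chartInv_apply (I := 𝓘(ℝ, E)) x₁ u
    (mfderiv 𝓘(ℝ, E) 𝓘(ℝ, E) (extChartAt 𝓘(ℝ, E) x₁) x v)
  rw [hux] at h
  exact h

/-! ### Chain rule for velocities and tangent lifts -/

omit [FiniteDimensional ℝ E] [CompleteSpace E] [IsManifold 𝓘(ℝ, E) ∞ M] in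
/-- `(Φ ∘ ĉ)'(t) = dΦ_{ĉ t}(ĉ' t)` for `Φ = chartInv x₁`. [folklore] -/
theorem velocity_chartInv_comp (x₁ : M) {ĉ : ℝ → chartTarget 𝓘(ℝ, E) x₁} {t : ℝ}
    (hΦ : MDifferentiableAt 𝓘(ℝ, E) 𝓘(ℝ, E) (chartInv 𝓘(ℝ, E) x₁) (ĉ t))
    (hĉ : MDifferentiableAt 𝓘(ℝ, ℝ) 𝓘(ℝ, E) ĉ t) :
    velocity 𝓘(ℝ, E) (chartInv 𝓘(ℝ, E) x₁ ∘ ĉ) t =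
      mfderiv 𝓘(ℝ, E) 𝓘(ℝ, E) (chartInv 𝓘(ℝ, E) x₁) (ĉ t) (velocity 𝓘(ℝ, E) ĉ t) := by
  simp only [velocity]
  rw [mfderiv_comp t hΦ hĉ]
  rfl

/-! ### Geodesics of the chart metric are carried to geodesics of `g` -/

variable [g.HasLeviCivita]

/-- **`chartInv` carries geodesics of the chart metric to geodesics of `g`.** If `ĉ` is a geodesic
of the Levi-Civita connection of `chartPullback g x₁` (the metric `g` read on the open chart target)
on an open set `J`, then `chartInv x₁ ∘ ĉ` is a geodesic of `g` on `J`, with velocity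
`D(chartInv)(ĉ')`: `D^g/dt (dΦ ĉ') = dΦ (D^{Φ^*g}/dt ĉ') = 0` by the naturality of the induced
covariant derivative (`mfderiv_covariantDerivAlong_comap`). [cite: ONeill1983, Ch. 3, Prop. 3.59] -/
theorem isGeodesicOn_chartInv_comp (x₁ : M) {ĉ : ℝ → chartTarget 𝓘(ℝ, E) x₁} {J : Set ℝ}
    (hJ : IsOpen J)
    (hĉ : haveI := (chartPullback 𝓘(ℝ, E) g x₁).hasLeviCivita
      IsGeodesicOn (chartPullback 𝓘(ℝ, E) g x₁).leviCivita ĉ J) :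
    IsGeodesicOn g.leviCivita (chartInv 𝓘(ℝ, E) x₁ ∘ ĉ) J ∧
      ∀ t ∈ J, velocity 𝓘(ℝ, E) (chartInv 𝓘(ℝ, E) x₁ ∘ ĉ) t =
        mfderiv 𝓘(ℝ, E) 𝓘(ℝ, E) (chartInv 𝓘(ℝ, E) x₁) (ĉ t) (velocity 𝓘(ℝ, E) ĉ t) := by
  haveI := (chartPullback 𝓘(ℝ, E) g x₁).hasLeviCivita
  set Φ := chartInv 𝓘(ℝ, E) x₁ with hΦdef
  have hΦs : ContMDiff 𝓘(ℝ, E) 𝓘(ℝ, E) ∞ Φ := (contMDiff_chartInv x₁).of_le le_self_add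
  have hΦd : ∀ u, MDifferentiableAt 𝓘(ℝ, E) 𝓘(ℝ, E) Φ u := fun u ↦
    (hΦs u).mdifferentiableAt (by simp)
  have h2 : (1 : ℕ∞ω) + 1 ≤ ∞ := by
    rw [one_add_one_eq_two]; exact WithTop.coe_le_coe.mpr le_top
  have hTΦ : ContMDiff 𝓘(ℝ, E).tangent 𝓘(ℝ, E).tangent 1 (tangentMap 𝓘(ℝ, E) 𝓘(ℝ, E) Φ) :=
    hΦs.contMDiff_tangentMap h2
  -- differentiability of `ĉ` and the chain rule on `J`
  have hĉd : ∀ t ∈ J, MDifferentiableAt 𝓘(ℝ, ℝ) 𝓘(ℝ, E) ĉ t := fun t ht ↦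
    mdifferentiableAt_of_mdifferentiableAt_lift (hĉ.1 t ht)
  have hvel : ∀ t ∈ J, velocity 𝓘(ℝ, E) (Φ ∘ ĉ) t =
      mfderiv 𝓘(ℝ, E) 𝓘(ℝ, E) Φ (ĉ t) (velocity 𝓘(ℝ, E) ĉ t) := fun t ht ↦
    velocity_chartInv_comp x₁ (hΦd _) (hĉd t ht)
  -- the tangent lift of `Φ ∘ ĉ` is `TΦ ∘` the tangent lift of `ĉ`, near every `t ∈ J`
  have hlift_eq : ∀ t ∈ J, tangentLift 𝓘(ℝ, E) (Φ ∘ ĉ) =ᶠ[𝓝 t]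
      fun t' ↦ tangentMap 𝓘(ℝ, E) 𝓘(ℝ, E) Φ (tangentLift 𝓘(ℝ, E) ĉ t') := by
    intro t ht
    filter_upwards [hJ.mem_nhds ht] with t' ht'
    simp only [tangentLift, tangentMap, Function.comp_apply]
    rw [hvel t' ht']
    rfl
  have hlift : ∀ t ∈ J, MDifferentiableAt 𝓘(ℝ, ℝ) 𝓘(ℝ, E).tangent
      (tangentLift 𝓘(ℝ, E) (Φ ∘ ĉ)) t := by
    intro t ht
    refine MDifferentiableAt.congr_of_eventuallyEq ?_ (hlift_eq t ht)
    exact ((hTΦ _).mdifferentiableAt one_ne_zero).comp t (hĉ.1 t ht)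
  refine ⟨⟨hlift, fun t ht ↦ ?_⟩, hvel⟩
  -- `D^g/dt (Φ∘ĉ)' = D^g/dt (dΦ ĉ') = dΦ (D/dt ĉ') = 0`
  have hcongr : covariantDerivAlong g.leviCivita (Φ ∘ ĉ) (fun t ↦ velocity 𝓘(ℝ, E) (Φ ∘ ĉ) t) t =
      covariantDerivAlong g.leviCivita (Φ ∘ ĉ)
        (fun t ↦ mfderiv 𝓘(ℝ, E) 𝓘(ℝ, E) Φ (ĉ t) (velocity 𝓘(ℝ, E) ĉ t)) t := by
    refine covariantDerivAlong_congr_field g.leviCivita ?_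
    filter_upwards [hJ.mem_nhds ht] with t' ht'
    exact hvel t' ht'
  have hnat := g.mfderiv_covariantDerivAlong_comap contMDiff_pullbackBilin_holds
    (contMDiff_chartInv x₁) (injective_mfderiv_chartInv x₁) rfl (hĉ.1 t ht)
  have h0 : covariantDerivAlong (g.comap contMDiff_pullbackBilin_holds (chartInv 𝓘(ℝ, E) x₁)
      (contMDiff_chartInv x₁) (injective_mfderiv_chartInv x₁) rfl).leviCivita ĉ
      (fun t ↦ velocity 𝓘(ℝ, E) ĉ t) t = 0 := hĉ.2 t ht
  rw [h0, map_zero] at hnat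
  rw [hcongr, hΦdef]
  exact hnat.symm

/-! ### The coordinate geodesic equations along a geodesic of `g` -/

/-- **The geodesic equations in a chart** (O'Neill 1983, Ch. 3, Cor. 3.21). Let `γ` be a geodesic
of the Levi-Civita connection of the smooth metric `g` on the open parameter set `s`, `t₀ ∈ s`,
and suppose `γ t₀` lies in the domain of the chart at `x₁`. Put `G = chartRep g x₁ 0` (the chart
components), `c = extChartAt x₁ ∘ γ` and `U = D(extChartAt x₁)(γ')` (the coordinate velocity).
Then for all `t` near `t₀`: `γ t` is in the chart domain, `c` has derivative `U t`, and `U` has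
derivative `−Γ_{c t}(U t, U t)`, `Γ = MetricCoord.chrAt G`. Proof: the coordinate system
`c' = U`, `U' = −Γ_c(U, U)` has a local solution (Picard–Lindelöf); it is a geodesic of the chart
metric (`OpensChart.isGeodesicOn_of_hasDerivAt`, `OpensChart.christoffel_eq_chrAt`), carried by
`chartInv` to a geodesic of `g` with the same initial point and velocity as `γ`, hence equal to `γ`
near `t₀` (uniqueness of geodesics). [cite: ONeill1983, Ch. 3, Cor. 3.21 and Lemma 3.22] -/
theorem IsGeodesicOn.eventually_hasDerivAt_chart [T2Space M] (x₁ : M) {γ : ℝ → M} {s : Set ℝ}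
    (hs : IsOpen s) (hγ : IsGeodesicOn g.leviCivita γ s) {t₀ : ℝ} (ht₀ : t₀ ∈ s)
    (hx : γ t₀ ∈ (extChartAt 𝓘(ℝ, E) x₁).source) :
    ∀ᶠ t in 𝓝 t₀, γ t ∈ (extChartAt 𝓘(ℝ, E) x₁).source ∧
      HasDerivAt (fun t ↦ extChartAt 𝓘(ℝ, E) x₁ (γ t))
        (mfderiv 𝓘(ℝ, E) 𝓘(ℝ, E) (extChartAt 𝓘(ℝ, E) x₁) (γ t) (velocity 𝓘(ℝ, E) γ t)) t ∧
      HasDerivAt (fun t ↦ mfderiv 𝓘(ℝ, E) 𝓘(ℝ, E) (extChartAt 𝓘(ℝ, E) x₁) (γ t)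
          (velocity 𝓘(ℝ, E) γ t))
        (-MetricCoord.chrAt (chartRep 𝓘(ℝ, E) (fun _ ↦ g) x₁ 0) (extChartAt 𝓘(ℝ, E) x₁ (γ t))
          (mfderiv 𝓘(ℝ, E) 𝓘(ℝ, E) (extChartAt 𝓘(ℝ, E) x₁) (γ t) (velocity 𝓘(ℝ, E) γ t))
          (mfderiv 𝓘(ℝ, E) 𝓘(ℝ, E) (extChartAt 𝓘(ℝ, E) x₁) (γ t) (velocity 𝓘(ℝ, E) γ t))) t := by
  haveI := (chartPullback 𝓘(ℝ, E) g x₁).hasLeviCivita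
  -- notation: the chart, its target, the components
  set φ := extChartAt 𝓘(ℝ, E) x₁ with hφ
  set G := chartRep 𝓘(ℝ, E) (fun _ ↦ g) x₁ 0 with hGdef
  set T : Set E := φ.target with hT
  have hTo : IsOpen T := isOpen_extChartAt_target x₁
  have hG := val_chartPullback_eq_chartRep (fun _ : ℝ ↦ g) x₁ 0
  have hGm : MetricCoord.IsMetricOn G T := Lorentzian.OpensChart.isMetricOn_repr hG
  have hGd : ∀ y : chartTarget 𝓘(ℝ, E) x₁, DifferentiableAt ℝ G y := fun y ↦
    hGm.differentiableAt y.2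
  set Φ := chartInv 𝓘(ℝ, E) x₁ with hΦdef
  -- initial data
  set c₀ : E := φ (γ t₀) with hc₀
  have hc₀T : c₀ ∈ T := φ.map_source hx
  set U₀ : E := mfderiv 𝓘(ℝ, E) 𝓘(ℝ, E) φ (γ t₀) (velocity 𝓘(ℝ, E) γ t₀) with hU₀
  -- (1) a local solution of the coordinate geodesic system
  set F : E × E → E × E := fun q ↦ (q.2, -MetricCoord.chrAt G q.1 q.2 q.2) with hF
  have hFs : ContDiffAt ℝ 1 F (c₀, U₀) := by
    have h0 : ContDiffAt ℝ 1 (MetricCoord.chrAt G) c₀ :=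
      (hGm.contDiffAt_chrAt hc₀T).of_le (by exact WithTop.coe_le_coe.mpr le_top)
    have h1 : ContDiffAt ℝ 1 (MetricCoord.chrAt G ∘ Prod.fst) (c₀, U₀) :=
      h0.comp (c₀, U₀) contDiffAt_fst
    have h2 : ContDiffAt ℝ 1 (fun q : E × E ↦ (MetricCoord.chrAt G ∘ Prod.fst) q q.2 q.2) (c₀, U₀) :=
      (h1.clm_apply contDiffAt_snd).clm_apply contDiffAt_snd
    exact contDiffAt_snd.prodMk h2.neg
  obtain ⟨q, hq0, ε, hε, hqd⟩ := hFs.exists_forall_mem_closedBall_exists_eq_forall_mem_Ioo_hasDerivAt₀ t₀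
  set c' : ℝ → E := fun t ↦ (q t).1 with hc'
  set U' : ℝ → E := fun t ↦ (q t).2 with hU'
  have hc'd : ∀ t ∈ Ioo (t₀ - ε) (t₀ + ε), HasDerivAt c' (U' t) t := fun t ht ↦
    ((ContinuousLinearMap.fst ℝ E E).hasFDerivAt.comp_hasDerivAt t (hqd t ht))
  have hU'd : ∀ t ∈ Ioo (t₀ - ε) (t₀ + ε),
      HasDerivAt U' (-MetricCoord.chrAt G (c' t) (U' t) (U' t)) t := fun t ht ↦
    ((ContinuousLinearMap.snd ℝ E E).hasFDerivAt.comp_hasDerivAt t (hqd t ht))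
  have hc'0 : c' t₀ = c₀ := by simp [hc', hq0]
  have hU'0 : U' t₀ = U₀ := by simp [hU', hq0]
  -- (2) a parameter interval `J ∋ t₀`, inside `s` and the existence interval, on which `c' ∈ T`
  obtain ⟨δ, hδ, hJ⟩ : ∃ δ > (0 : ℝ), Ioo (t₀ - δ) (t₀ + δ) ⊆
      {t | t ∈ s ∧ t ∈ Ioo (t₀ - ε) (t₀ + ε) ∧ c' t ∈ T} := by
    have h1 : ∀ᶠ t in 𝓝 t₀, t ∈ s := hs.mem_nhds ht₀
    have h2 : ∀ᶠ t in 𝓝 t₀, t ∈ Ioo (t₀ - ε) (t₀ + ε) :=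
      isOpen_Ioo.mem_nhds ⟨by linarith, by linarith⟩
    have h3 : ∀ᶠ t in 𝓝 t₀, c' t ∈ T := by
      have hca : ContinuousAt c' t₀ := (hc'd t₀ ⟨by linarith, by linarith⟩).continuousAt
      exact hca.preimage_mem_nhds (by rw [hc'0]; exact hTo.mem_nhds hc₀T)
    obtain ⟨δ, hδ, hball⟩ := Metric.eventually_nhds_iff_ball.mp (h1.and (h2.and h3))
    refine ⟨δ, hδ, fun t ht ↦ hball t ?_⟩
    rw [Real.ball_eq_Ioo]; exact ht
  set J : Set ℝ := Ioo (t₀ - δ) (t₀ + δ) with hJdef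
  have hJo : IsOpen J := isOpen_Ioo
  have ht₀J : t₀ ∈ J := ⟨by linarith, by linarith⟩
  have hJs : J ⊆ s := fun t ht ↦ (hJ ht).1
  have hJε : J ⊆ Ioo (t₀ - ε) (t₀ + ε) := fun t ht ↦ (hJ ht).2.1
  have hJT : ∀ t ∈ J, c' t ∈ T := fun t ht ↦ (hJ ht).2.2
  -- (3) the solution as a curve in the open chart target, a geodesic of the chart metric
  classical
  set ĉ : ℝ → chartTarget 𝓘(ℝ, E) x₁ := fun t ↦
    if h : c' t ∈ T then ⟨c' t, h⟩ else ⟨c₀, hc₀T⟩ with hĉdef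
  have hĉJ : ∀ t ∈ J, (ĉ t : E) = c' t := fun t ht ↦ by
    simp only [hĉdef, dif_pos (hJT t ht)]
  have hĉev : ∀ t ∈ J, (fun t' ↦ (ĉ t' : E)) =ᶠ[𝓝 t] c' := fun t ht ↦ by
    filter_upwards [hJo.mem_nhds ht] with t' ht'
    exact hĉJ t' ht'
  have hcd : ∀ t ∈ J, HasDerivAt (fun t' ↦ (ĉ t' : E)) (U' t) t := fun t ht ↦
    (hc'd t (hJε ht)).congr_of_eventuallyEq (hĉev t ht)
  have hgeo_eq : ∀ t ∈ J, -MetricCoord.chrAt G (c' t) (U' t) (U' t) +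
      OpensChart.christoffel (chartPullback 𝓘(ℝ, E) g x₁) G (ĉ t) (U' t) (U' t) = 0 := by
    intro t ht
    rw [OpensChart.christoffel_eq_chrAt hG (ĉ t) (U' t) (U' t), hĉJ t ht, neg_add_cancel]
  obtain ⟨hĉgeo, hĉvel⟩ := OpensChart.isGeodesicOn_of_hasDerivAt hG hGd hJo (fun _ ↦ rfl) hcd
    (fun t ht ↦ hU'd t (hJε ht)) hgeo_eq
  -- (4) its image under `chartInv` is a geodesic of `g` with the initial data of `γ`
  obtain ⟨hσgeo, hσvel⟩ := isGeodesicOn_chartInv_comp g x₁ hJo hĉgeo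
  have hĉt₀ : ĉ t₀ = ⟨c₀, hc₀T⟩ := by
    apply Subtype.ext
    rw [hĉJ t₀ ht₀J, hc'0]
  have hσ0 : (Φ ∘ ĉ) t₀ = γ t₀ := by
    simp only [Function.comp_apply, hĉt₀, hΦdef, hc₀]
    exact φ.left_inv hx
  have hσv : velocity 𝓘(ℝ, E) (Φ ∘ ĉ) t₀ = velocity 𝓘(ℝ, E) γ t₀ := by
    rw [hσvel t₀ ht₀J, hĉvel t₀ ht₀J, hU'0, hĉt₀]
    exact mfderiv_chartInv_mfderiv_extChartAt x₁ hx _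
  -- (5) uniqueness of geodesics: `γ = Φ ∘ ĉ` on `J`
  have heq : EqOn γ (Φ ∘ ĉ) J :=
    eqOn_of_isGeodesicOn g hJo ordConnected_Ioo (hγ.mono hJs) hσgeo ht₀J hσ0.symm hσv.symm
  -- (6) read off the coordinate expression and velocity of `γ` on `J`
  have hγJ : ∀ t ∈ J, γ t ∈ φ.source := fun t ht ↦ by
    rw [heq ht]
    simpa [hΦdef, hφ, extChartAt_source] using chartInv_mem_source (I := 𝓘(ℝ, E)) x₁ (ĉ t)
  have hcJ : ∀ t ∈ J, φ (γ t) = c' t := fun t ht ↦ by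
    rw [heq ht, Function.comp_apply, ← hĉJ t ht]
    exact extChartAt_chartInv x₁ (ĉ t)
  have hUJ : ∀ t ∈ J, mfderiv 𝓘(ℝ, E) 𝓘(ℝ, E) φ (γ t) (velocity 𝓘(ℝ, E) γ t) = U' t := by
    intro t ht
    have hev : γ =ᶠ[𝓝 t] (Φ ∘ ĉ) := Filter.eventuallyEq_of_mem (hJo.mem_nhds ht) heq
    have hv : velocity 𝓘(ℝ, E) γ t = velocity 𝓘(ℝ, E) (Φ ∘ ĉ) t :=
      DFunLike.congr_fun hev.mfderiv_eq (1 : ℝ)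
    rw [hv, heq ht, hσvel t ht, hĉvel t ht]
    exact mfderiv_extChartAt_chartInv_apply x₁ (ĉ t) (U' t)
  -- conclusion
  filter_upwards [hJo.mem_nhds ht₀J] with t ht
  have hev1 : (fun t ↦ φ (γ t)) =ᶠ[𝓝 t] c' :=
    Filter.eventuallyEq_of_mem (hJo.mem_nhds ht) fun t' ht' ↦ hcJ t' ht'
  have hev2 : (fun t ↦ mfderiv 𝓘(ℝ, E) 𝓘(ℝ, E) φ (γ t) (velocity 𝓘(ℝ, E) γ t)) =ᶠ[𝓝 t] U' :=
    Filter.eventuallyEq_of_mem (hJo.mem_nhds ht) fun t' ht' ↦ hUJ t' ht'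
  refine ⟨hγJ t ht, ?_, ?_⟩
  · rw [hUJ t ht]
    exact (hc'd t (hJε ht)).congr_of_eventuallyEq hev1
  · rw [hUJ t ht, hcJ t ht]
    exact (hU'd t (hJε ht)).congr_of_eventuallyEq hev2

end Literature.Geometry.Riemannian

end
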